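import Literature.Analysis.FluidPDE.NSLocalAnalyticityRadius
import Literature.Analysis.Complex.OsgoodProofs
import Literature.Analysis.Complex.RealEnvironment
import HarnessLib

/-!
# The local complex region `Ω_*(t)`: openness, convexity, identity principle, gluing

Analysis/FluidPDE proofs file (theorems only; no definitions, no named facts), companion of
`NSLocalAnalyticityRadius.lean` (the named fact
`bradshawGrujicKukavica2015_local_analyticity_radius`, Bradshaw–Grujić–Kukavica, J. Differential
Equations 259 (2015), Thm. 2.3 = LMS Lecture Notes 430 (2016), Thm. 2.3.1: the slices of a locally
smooth solution of 3D NSE agree on `B_*` with maps holomorphic on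
`Ω_*(t) = {x + iy : x ∈ B_*, |y| < √t/(4C₀)}` = `localComplexTube x_* r_* (√t/(4C₀))`).

This file supplies the geometric glue that every proof of the fact, and its consumers, need:

* `complexify_add_I_smul_mem_localComplexTube_iff`, `ball_complexify_subset_localComplexTube`,
  `isOpen_localComplexTube`, `convex_localComplexTube`, `isPreconnected_localComplexTube` — the
  region is an open convex subset of `ℂ³` containing, about each real point of the ball, a complex
  ball;
* `eqOn_localComplexTube_of_forall_complexify_eq` — **identity principle from the real ball**: two
  maps holomorphic on the region which agree at the real points `x ∈ B_*` agree on the region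
  (coordinatewise: Osgood's lemma
  `Literature.Analysis.Complex.SCV.analyticOnNhd_of_differentiableOn`
  makes the difference analytic on the preconnected open region, and the real-environment
  principle `Literature.Analysis.Complex.SCV.eventually_eq_zero_of_eq_zero_on_reals`
  (Streater–Wightman §2-3) makes it vanish near the real centre). In particular the holomorphic
  extension asserted by the fact is unique;
* `exists_differentiableOn_localComplexTube_of_forall_lt` — **gluing over increasing heights**:
  extensions of one real map to the regions of all heights `h' < h` patch to an extension to the
  region of height `h` (BGK 2015, proof of Thm. 2.1, p. 16: the limit extensions on increasing
  regions are identified through their common real restriction). This is the exhaustion step by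
  which the fact (stated without initial datum, on the open time interval) is reduced to
  solutions smooth across the initial time (`NSLocalAnalyticityRadiusReduction.lean`).

## Mathlib / tree search

Tree: `localComplexTube`, `localComplexTube_mono`, `localComplexTube_eq_empty`,
`complexify_mem_localComplexTube` (`NSLocalAnalyticityRadius.lean`); `complexTube`,
`exists_eq_complexify_add_I_smul_complexify`, `re/im_complexify_add_I_smul_complexify_apply`,
`isOpen_complexTube` (`NSAnalyticityRadiusLinfty.lean`, the model for `isOpen_localComplexTube`);
`SCV.analyticOnNhd_of_differentiableOn` (`Complex/OsgoodProofs.lean`),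
`SCV.eventually_eq_zero_of_eq_zero_on_reals` (`Complex/RealEnvironment.lean`). Mathlib:
`AnalyticOnNhd.eqOn_zero_of_preconnected_of_eventuallyEq_zero`, `Convex.isPreconnected`,
`EuclideanSpace.proj`, `DifferentiableAt.congr_of_eventuallyEq`.

## References

* Z. Bradshaw, Z. Grujić, I. Kukavica, J. Differential Equations 259 (2015) 3955–3975, proof of
  Thm. 2.1 (p. 16) and §4. [BradshawGrujicKukavica2015]
* R. F. Streater, A. S. Wightman, *PCT, Spin and Statistics, and All That* (1964), §2-3 (real
  environments). [StreaterWightman1964]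
-/

noncomputable section

open MeasureTheory Set Function Filter TopologicalSpace Metric
open _root_.Topology
open scoped ContDiff Laplacian InnerProductSpace RealInnerProductSpace
open Literature.Analysis.FunctionSpaces.EuclideanSpace (complexify complexify_apply norm_complexify
  complexify_injective continuous_complexify)

namespace Literature.Analysis.FluidPDE

/-! ### Geometry of the local region: real and imaginary parts, openness, convexity

The glue used by every proof of the fact (BGK 2015, proof of Thm. 2.1, p. 16: the analytic
extensions obtained on increasing regions are identified through their common real restriction)
and by its consumers: the local region `Ω_*(t)` is open and convex, a holomorphic map on it is
determined by its values on the real ball `B_*` (identity principle from a real environment,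
`Literature.Analysis.Complex.SCV.eventually_eq_zero_of_eq_zero_on_reals`, plus Osgood's lemma
`Literature.Analysis.Complex.SCV.analyticOnNhd_of_differentiableOn`), and holomorphic extensions
on the regions of all heights `h' < h` glue to one on the region of height `h`. -/

section TubeGeometry

/-- The Euclidean norm of a real vector is at most that of a complex vector dominating it
coordinatewise. [folklore] -/
theorem norm_le_of_forall_abs_le_norm_apply {x : EuclideanSpace ℝ (Fin 3)}
    {v : EuclideanSpace ℂ (Fin 3)}
    (h : ∀ i, |x i| ≤ ‖v i‖) :
    ‖x‖ ≤ ‖v‖ := by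
  rw [EuclideanSpace.norm_eq, EuclideanSpace.norm_eq]
  refine Real.sqrt_le_sqrt (Finset.sum_le_sum fun i _ => ?_)
  rw [Real.norm_eq_abs]
  exact pow_le_pow_left₀ (abs_nonneg _) (h i) 2

/-- Every `v ∈ ℂ³` is `complexify a + I • complexify b` with `‖complexify a‖, ‖complexify b‖ ≤ ‖v‖`
(`a = Re v`, `b = Im v` coordinatewise): `complexify` is a real structure of `ℂ³` in the sense of
`Literature.Analysis.Complex.SCV.eventually_eq_zero_of_eq_zero_on_reals`. [folklore] -/
theorem exists_eq_complexify_add_I_smul_norm_le (v : EuclideanSpace ℂ (Fin 3)) :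
    ∃ a b : EuclideanSpace ℝ (Fin 3), v = complexify a + Complex.I • complexify b ∧
      ‖complexify a‖ ≤ 1 * ‖v‖ ∧ ‖complexify b‖ ≤ 1 * ‖v‖ := by
  obtain ⟨a, b, hv, ha, hb⟩ := exists_eq_complexify_add_I_smul_complexify v
  refine ⟨a, b, hv, ?_, ?_⟩
  · rw [one_mul, norm_complexify]
    exact norm_le_of_forall_abs_le_norm_apply fun i => by
      rw [ha i]; exact Complex.abs_re_le_norm _
  · rw [one_mul, norm_complexify]
    exact norm_le_of_forall_abs_le_norm_apply fun i => by
      rw [hb i]; exact Complex.abs_im_le_norm _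

/-- `complexify x + I • complexify y` lies in the local region iff `dist x x₀ < ρ` and `‖y‖ < h`
(the decomposition into real and imaginary parts is unique). [folklore] -/
theorem complexify_add_I_smul_mem_localComplexTube_iff {x₀ x y : EuclideanSpace ℝ (Fin 3)}
    {ρ h : ℝ} :
    complexify x + Complex.I • complexify y ∈ localComplexTube x₀ ρ h ↔
      dist x x₀ < ρ ∧ ‖y‖ < h := by
  refine ⟨?_, fun hxy => ⟨x, y, hxy.1, hxy.2, rfl⟩⟩
  rintro ⟨x', y', hx', hy', hz⟩
  have hxx' : x = x' := by
    ext i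
    have hi := congrArg (fun w : EuclideanSpace ℂ (Fin 3) => (w i).re) hz
    simpa only [re_complexify_add_I_smul_complexify_apply] using hi
  have hyy' : y = y' := by
    ext i
    have hi := congrArg (fun w : EuclideanSpace ℂ (Fin 3) => (w i).im) hz
    simpa only [im_complexify_add_I_smul_complexify_apply] using hi
  rw [hxx', hyy']
  exact ⟨hx', hy'⟩

/-- A point of the local region of height `h` lies in a local region of strictly smaller height.
[folklore] -/
theorem exists_lt_mem_localComplexTube {x₀ : EuclideanSpace ℝ (Fin 3)} {ρ h : ℝ}
    {z : EuclideanSpace ℂ (Fin 3)}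
    (hz : z ∈ localComplexTube x₀ ρ h) : ∃ h' < h, z ∈ localComplexTube x₀ ρ h' := by
  obtain ⟨x, y, hx, hy, rfl⟩ := hz
  exact ⟨(‖y‖ + h) / 2, by linarith, x, y, hx, by linarith, rfl⟩

/-- **A ball about a real point inside the local region**: if `dist x x₀ + ε ≤ ρ` and `ε ≤ h`
then `ball (complexify x) ε ⊆ Ω`: for `z` in the ball,
`‖Re z - x‖, ‖Im z‖ ≤ ‖z - complexify x‖ < ε`.
[folklore] -/
theorem ball_complexify_subset_localComplexTube {x₀ x : EuclideanSpace ℝ (Fin 3)} {ρ h ε : ℝ}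
    (hxε : dist x x₀ + ε ≤ ρ) (hε : ε ≤ h) :
    ball (complexify x) ε ⊆ localComplexTube x₀ ρ h := by
  intro z hz
  rw [mem_ball, dist_eq_norm] at hz
  obtain ⟨a, b, hzab, ha, hb⟩ := exists_eq_complexify_add_I_smul_complexify z
  have hsub : z - complexify x = complexify (a - x) + Complex.I • complexify b := by
    rw [hzab, map_sub]; abel
  have ha' : ‖a - x‖ < ε := by
    refine lt_of_le_of_lt
      (norm_le_of_forall_abs_le_norm_apply (v := z - complexify x) fun i => ?_) hz
    have hi := Complex.abs_re_le_norm ((complexify (a - x) + Complex.I • complexify b) i)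
    rwa [re_complexify_add_I_smul_complexify_apply, ← hsub] at hi
  have hb' : ‖b‖ < ε := by
    refine lt_of_le_of_lt
      (norm_le_of_forall_abs_le_norm_apply (v := z - complexify x) fun i => ?_) hz
    have hi := Complex.abs_im_le_norm ((complexify (a - x) + Complex.I • complexify b) i)
    rwa [im_complexify_add_I_smul_complexify_apply, ← hsub] at hi
  rw [hzab, complexify_add_I_smul_mem_localComplexTube_iff]
  refine ⟨?_, hb'.trans_le hε⟩
  calc dist a x₀ ≤ dist a x + dist x x₀ := dist_triangle _ _ _
    _ < ε + dist x x₀ := by rw [dist_eq_norm]; gcongr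
    _ ≤ ρ := by linarith

/-- **The local region is open**: it is the intersection of the preimages of the balls
`ball x₀ ρ` and `ball 0 h` under the continuous real- and imaginary-part maps. [folklore] -/
theorem isOpen_localComplexTube (x₀ : EuclideanSpace ℝ (Fin 3)) (ρ h : ℝ) :
    IsOpen (localComplexTube x₀ ρ h) := by
  set re : EuclideanSpace ℂ (Fin 3) → EuclideanSpace ℝ (Fin 3) :=
    fun z => WithLp.toLp 2 fun i => (z i).re with hre_def
  set im : EuclideanSpace ℂ (Fin 3) → EuclideanSpace ℝ (Fin 3) :=
    fun z => WithLp.toLp 2 fun i => (z i).im with him_def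
  have hre : Continuous re := by
    rw [hre_def]
    fun_prop
  have him : Continuous im := by
    rw [him_def]
    fun_prop
  have heq : localComplexTube x₀ ρ h = re ⁻¹' ball x₀ ρ ∩ im ⁻¹' ball 0 h := by
    ext z
    obtain ⟨x, y, hz, hx, hy⟩ := exists_eq_complexify_add_I_smul_complexify z
    have hxz : re z = x := by
      ext i
      exact (hx i).symm
    have hyz : im z = y := by
      ext i
      exact (hy i).symm
    rw [hz, complexify_add_I_smul_mem_localComplexTube_iff, ← hz, mem_inter_iff, mem_preimage,
      mem_preimage, hxz, hyz, mem_ball, mem_ball_zero_iff]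
  rw [heq]
  exact (isOpen_ball.preimage hre).inter (isOpen_ball.preimage him)

/-- **The local region is convex** (the image of `ball x₀ ρ × ball 0 h` under the real-linear map
`(x, y) ↦ x + iy`), hence preconnected. [folklore] -/
theorem convex_localComplexTube (x₀ : EuclideanSpace ℝ (Fin 3)) (ρ h : ℝ) :
    Convex ℝ (localComplexTube x₀ ρ h) := by
  rintro z₁ ⟨x₁, y₁, hx₁, hy₁, rfl⟩ z₂ ⟨x₂, y₂, hx₂, hy₂, rfl⟩ a b ha hb hab
  refine ⟨a • x₁ + b • x₂, a • y₁ + b • y₂, ?_, ?_, ?_⟩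
  · exact (convex_ball x₀ ρ) (show x₁ ∈ ball x₀ ρ from hx₁) (show x₂ ∈ ball x₀ ρ from hx₂)
      ha hb hab
  · exact mem_ball_zero_iff.1 ((convex_ball (0 : EuclideanSpace ℝ (Fin 3)) h)
      (mem_ball_zero_iff.2 hy₁) (mem_ball_zero_iff.2 hy₂) ha hb hab)
  · rw [map_add, map_add, LinearIsometry.map_smul, LinearIsometry.map_smul,
      LinearIsometry.map_smul, LinearIsometry.map_smul, smul_add, smul_add, smul_add,
      smul_comm a Complex.I, smul_comm b Complex.I]
    abel

/-- The local region is preconnected. [folklore] -/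
theorem isPreconnected_localComplexTube (x₀ : EuclideanSpace ℝ (Fin 3)) (ρ h : ℝ) :
    IsPreconnected (localComplexTube x₀ ρ h) :=
  (convex_localComplexTube x₀ ρ h).isPreconnected

/-! ### Identity principle and gluing of holomorphic extensions over the real ball -/

/-- **Identity principle on the local region**: two maps holomorphic on
`Ω = localComplexTube x₀ ρ h` which agree at the real points `complexify x`, `x ∈ ball x₀ ρ`,
agree on `Ω` — coordinatewise, the difference is analytic (Osgood) on the preconnected open `Ω`
and vanishes near the real centre by the real-environment principle. In particular the
holomorphic extension of a slice `u(t)|_{B_*}` to `Ω_*(t)` asserted by the fact is unique.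
[cite: StreaterWightman1964, §2-3 (pdf p. 46)] -/
theorem eqOn_localComplexTube_of_forall_complexify_eq {x₀ : EuclideanSpace ℝ (Fin 3)} {ρ h : ℝ}
    {U₁ U₂ : EuclideanSpace ℂ (Fin 3) → EuclideanSpace ℂ (Fin 3)}
    (hU₁ : DifferentiableOn ℂ U₁ (localComplexTube x₀ ρ h))
    (hU₂ : DifferentiableOn ℂ U₂ (localComplexTube x₀ ρ h))
    (heq : ∀ x ∈ ball x₀ ρ, U₁ (complexify x) = U₂ (complexify x)) :
    EqOn U₁ U₂ (localComplexTube x₀ ρ h) := by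
  rcases le_or_gt h 0 with hh | hh
  · rw [localComplexTube_eq_empty hh]
    exact eqOn_empty _ _
  rcases le_or_gt ρ 0 with hρ | hρ
  · rintro z ⟨x, y, hx, -, -⟩
    exact absurd (hx.trans_le hρ) (not_lt.2 dist_nonneg)
  have hT : IsOpen (localComplexTube x₀ ρ h) := isOpen_localComplexTube x₀ ρ h
  have hx₀ : complexify x₀ ∈ localComplexTube x₀ ρ h :=
    complexify_mem_localComplexTube hh (by simpa using hρ)
  -- a ball about the real centre inside the region
  have hδ : 0 < min ρ h := lt_min hρ hh
  have hball : ball (complexify x₀) (min ρ h) ⊆ localComplexTube x₀ ρ h :=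
    ball_complexify_subset_localComplexTube (by simp) (min_le_right _ _)
  intro z hz
  ext i
  set f : EuclideanSpace ℂ (Fin 3) → ℂ := fun w => U₁ w i - U₂ w i with hf_def
  have hf : DifferentiableOn ℂ f (localComplexTube x₀ ρ h) := by
    have h1 : DifferentiableOn ℂ (fun w => U₁ w i) (localComplexTube x₀ ρ h) :=
      (EuclideanSpace.proj (𝕜 := ℂ) i).differentiable.comp_differentiableOn hU₁
    have h2 : DifferentiableOn ℂ (fun w => U₂ w i) (localComplexTube x₀ ρ h) :=
      (EuclideanSpace.proj (𝕜 := ℂ) i).differentiable.comp_differentiableOn hU₂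
    exact h1.sub h2
  have hfa : AnalyticOnNhd ℂ f (localComplexTube x₀ ρ h) :=
    Literature.Analysis.Complex.SCV.analyticOnNhd_of_differentiableOn hf hT
  have hev : ∀ᶠ w in 𝓝 (complexify x₀), f w = 0 := by
    refine Literature.Analysis.Complex.SCV.eventually_eq_zero_of_eq_zero_on_reals
      (V := EuclideanSpace ℂ (Fin 3)) (W := EuclideanSpace ℝ (Fin 3)) complexify
      (fun a b => map_add _ a b)
      (fun t a => by rw [LinearIsometry.map_smul, Complex.coe_smul]) zero_le_one
      exists_eq_complexify_add_I_smul_norm_le hδ (hf.mono hball) fun w hw => ?_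
    have hwball : w ∈ ball x₀ ρ := by
      rw [mem_ball, dist_eq_norm, ← norm_complexify, map_sub]
      exact hw.trans_le (min_le_left _ _)
    simp [hf_def, heq w hwball]
  have hzero := hfa.eqOn_zero_of_preconnected_of_eventuallyEq_zero
    (isPreconnected_localComplexTube x₀ ρ h) hx₀ hev hz
  simpa [hf_def, sub_eq_zero] using hzero

/-- **Gluing holomorphic extensions over increasing heights** (the exhaustion step of BGK 2015,
proof of Thm. 2.1, p. 16: extensions on increasing regions with the same real restriction define
one analytic function on the union). If for every `h' < h` the map `f : ℝ³ → ℝ³` has a holomorphic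
extension from `ball x₀ ρ` to the local region of height `h'`, it has one to the region of height
`h`: the extensions agree on overlaps (`eqOn_localComplexTube_of_forall_complexify_eq`), and the
region of height `h` is the union of the open regions of smaller height.
[cite: BradshawGrujicKukavica2015, proof of Thm. 2.1 (p. 16)] -/
theorem exists_differentiableOn_localComplexTube_of_forall_lt {x₀ : EuclideanSpace ℝ (Fin 3)}
    {ρ h : ℝ}
    {f : EuclideanSpace ℝ (Fin 3) → EuclideanSpace ℝ (Fin 3)}
    (H : ∀ h' < h, ∃ U : EuclideanSpace ℂ (Fin 3) → EuclideanSpace ℂ (Fin 3),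
      DifferentiableOn ℂ U (localComplexTube x₀ ρ h') ∧
      ∀ x ∈ ball x₀ ρ, U (complexify x) = complexify (f x)) :
    ∃ U : EuclideanSpace ℂ (Fin 3) → EuclideanSpace ℂ (Fin 3),
      DifferentiableOn ℂ U (localComplexTube x₀ ρ h) ∧
      ∀ x ∈ ball x₀ ρ, U (complexify x) = complexify (f x) := by
  rcases le_or_gt h 0 with hh | hh
  · obtain ⟨U, -, hUf⟩ := H (h - 1) (by linarith)
    refine ⟨U, ?_, hUf⟩
    rw [localComplexTube_eq_empty hh]
    exact differentiableOn_empty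
  choose! U hUd hUf using H
  -- a height `g z < h` with `z ∈ Ω(g z)` for every `z ∈ Ω(h)`
  have hex : ∀ z ∈ localComplexTube x₀ ρ h, ∃ h' < h, z ∈ localComplexTube x₀ ρ h' :=
    fun z hz => exists_lt_mem_localComplexTube hz
  choose! g hg hgmem using hex
  refine ⟨fun z => U (g z) z, ?_, ?_⟩
  · -- on each `Ω(h₁)`, `h₁ < h`, the glued map is `U h₁`
    have hagree : ∀ h₁ < h, EqOn (fun z => U (g z) z) (U h₁) (localComplexTube x₀ ρ h₁) := by
      intro h₁ hh₁ z hz₁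
      have hz : z ∈ localComplexTube x₀ ρ h := localComplexTube_mono le_rfl hh₁.le hz₁
      -- `z` lies in the region of height `min (g z) h₁`, where `U (g z)` and `U h₁` agree
      have hzmin : z ∈ localComplexTube x₀ ρ (min (g z) h₁) := by
        obtain ⟨x, y, hx, hy, rfl⟩ := hgmem z hz
        have hy₁ : ‖y‖ < h₁ := (complexify_add_I_smul_mem_localComplexTube_iff.1 hz₁).2
        exact ⟨x, y, hx, lt_min hy hy₁, rfl⟩
      exact eqOn_localComplexTube_of_forall_complexify_eq
        ((hUd (g z) (hg z hz)).mono (localComplexTube_mono le_rfl (min_le_left _ _)))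
        ((hUd h₁ hh₁).mono (localComplexTube_mono le_rfl (min_le_right _ _)))
        (fun x hx => by rw [hUf (g z) (hg z hz) x hx, hUf h₁ hh₁ x hx]) hzmin
    intro z hz
    have h₁lt : g z < h := hg z hz
    have hz₁ : z ∈ localComplexTube x₀ ρ (g z) := hgmem z hz
    have hopen : IsOpen (localComplexTube x₀ ρ (g z)) := isOpen_localComplexTube x₀ ρ (g z)
    have hdiff : DifferentiableAt ℂ (U (g z)) z :=
      (hUd (g z) h₁lt).differentiableAt (hopen.mem_nhds hz₁)
    have hev : (fun w => U (g w) w) =ᶠ[𝓝 z] U (g z) :=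
      Filter.eventuallyEq_of_mem (hopen.mem_nhds hz₁) (hagree (g z) h₁lt)
    exact (hdiff.congr_of_eventuallyEq hev).differentiableWithinAt
  · intro x hx
    have hxmem : complexify x ∈ localComplexTube x₀ ρ h := complexify_mem_localComplexTube hh hx
    exact hUf (g (complexify x)) (hg _ hxmem) x hx

end TubeGeometry

end Literature.Analysis.FluidPDE

end
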